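import Literature.AnabelianGeometry.AbsoluteAnabelian.AbsTopII.InertiaGroups
import Literature.AnabelianGeometry.AbsoluteAnabelian.FundamentalExtension
import Mathlib.Topology.Algebra.OpenSubgroup
import HarnessLib

/-!
# `IsFreeProSigmaCyclic Σ` ([AbsTopII] Prop 1.3 (i)) for `Σ` = all primes is `IsFreeProcyclic`

[AbsTopII] Prop 1.3 (i) p. 11 says the edge-like subgroups are "as abstract profinite groups, `≅
Ẑ^Σ`"; abc-iut-L4-t6 typed this intrinsically as `AbsTopII.IsFreeProSigmaCyclic Σ G` (a dense cyclic
subgroup; the indices of open subgroups are exactly the `Σ`-integers). abc-iut-L4-t1's interface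
predicate `FundamentalExtension.IsFreeProcyclic G` (the `I_x ≅ Ẑ` clauses of [AbsTopIII] §1: a dense
cyclic subgroup; an open subgroup of every positive index) is the case `Σ = Primes`. This proof-only
file (no definitions) records the comparison, so that either predicate may be fed to the other's
consumers (audit RQ7 F1 of abc-iut-L6-t22 pointed the `I ≅ ℤ_l` clause of [AbsTopI] Lem 4.5 (iv) to
these predicates): `IsFreeProSigmaCyclic Set.univ G → IsFreeProcyclic G` always, and the converse
for compact `G` (open subgroups of a compact group have finite, hence positive, index).
-/

namespace Literature.AnabelianGeometry.AbsoluteAnabelian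

open Literature.AnabelianGeometry.Anabelioids (IsSigmaInteger)

universe u

variable {G : Type u} [Group G] [TopologicalSpace G]

/-- A natural number is a `Σ`-integer for `Σ` = all primes iff it is positive. [folklore] -/
private theorem isSigmaInteger_univ_iff (n : ℕ) : IsSigmaInteger Set.univ n ↔ 0 < n :=
  ⟨fun h => h.1, fun h => ⟨h, fun _ _ _ => Set.mem_univ _⟩⟩

/-- `Ẑ^Σ` for `Σ` = all primes is `Ẑ`: `IsFreeProSigmaCyclic Set.univ G → IsFreeProcyclic G`.
[cite: MochizukiAbsTopII2013, Prop 1.3 (i) p.11] -/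
theorem AbsTopII.IsFreeProSigmaCyclic.isFreeProcyclic
    (h : AbsTopII.IsFreeProSigmaCyclic Set.univ G) : FundamentalExtension.IsFreeProcyclic G where
  exists_dense_zpowers := h.exists_dense_zpowers
  exists_isOpen_index n hn := (h.isOpen_index_iff n).mpr ((isSigmaInteger_univ_iff n).mpr hn)

/-- Conversely, for a COMPACT topological group (e.g. a closed subgroup of a profinite group, such
as an inertia group `I_x ⊆ Π`), `IsFreeProcyclic G → IsFreeProSigmaCyclic Set.univ G`: an open
subgroup of a compact group has finite index, so index `0` does not occur.
[cite: MochizukiAbsTopII2013, Prop 1.3 (i) p.11] -/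
theorem FundamentalExtension.IsFreeProcyclic.isFreeProSigmaCyclic_univ [IsTopologicalGroup G]
    [CompactSpace G] (h : FundamentalExtension.IsFreeProcyclic G) :
    AbsTopII.IsFreeProSigmaCyclic Set.univ G where
  exists_dense_zpowers := h.exists_dense_zpowers
  isOpen_index_iff n := by
    rw [isSigmaInteger_univ_iff]
    constructor
    · rintro ⟨H, hH, rfl⟩
      haveI : Finite (G ⧸ H) := Subgroup.quotient_finite_of_isOpen H hH
      haveI : H.FiniteIndex := Subgroup.finiteIndex_of_finite_quotient
      exact Nat.pos_of_ne_zero Subgroup.FiniteIndex.index_ne_zero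
    · exact h.exists_isOpen_index n

/-- For a compact topological group the two interface predicates AGREE:
`IsFreeProSigmaCyclic Set.univ G ↔ IsFreeProcyclic G`.
[cite: MochizukiAbsTopII2013, Prop 1.3 (i) p.11] -/
theorem AbsTopII.isFreeProSigmaCyclic_univ_iff_isFreeProcyclic [IsTopologicalGroup G]
    [CompactSpace G] :
    AbsTopII.IsFreeProSigmaCyclic Set.univ G ↔ FundamentalExtension.IsFreeProcyclic G :=
  ⟨AbsTopII.IsFreeProSigmaCyclic.isFreeProcyclic,
    FundamentalExtension.IsFreeProcyclic.isFreeProSigmaCyclic_univ⟩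

/-- A `Ẑ^Σ`-group with some prime `q ∉ Σ` is not `Ẑ`: `IsFreeProSigmaCyclic Σ G` excludes an open
subgroup of index `q`, which `IsFreeProcyclic` demands.
[cite: MochizukiAbsTopII2013, Prop 1.3 (i) p.11] -/
theorem AbsTopII.IsFreeProSigmaCyclic.not_isFreeProcyclic {S : Set ℕ}
    (h : AbsTopII.IsFreeProSigmaCyclic S G) {q : ℕ} (hq : q.Prime) (hqS : q ∉ S) :
    ¬ FundamentalExtension.IsFreeProcyclic G := by
  intro hG
  obtain ⟨H, hH, hidx⟩ := hG.exists_isOpen_index q hq.pos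
  have hS : IsSigmaInteger S q := (h.isOpen_index_iff q).mp ⟨H, hH, hidx⟩
  exact hqS (hS.2 q hq (dvd_refl q))

end Literature.AnabelianGeometry.AbsoluteAnabelian
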